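/-
COR-CM (cell pub-hodgecm2, stage 2 of the Hodge ladder) — count-neutral KERNEL COMBINATORICS «μ = φ₂ for EVERY group of order 2, 4 or 8 and EVERY
central involution» (seat prover-pub-hodgecm2-b23-g50-0, binder prover b23, gen 50; own census lane INDEX-TWO CYCLIC 2-GROUPS, extension «SMALL DEGREES»,
claim HOME/INBOX.md l.23042, INTERIM #1 l.23124).  Theorems only; the capstone `Census/IndexTwoCyclicTwoGroups.lean` (this seat) and seat b09ʼs abelian
law `Census/AbelianTwistDatum.lean` (`TwistGeneration.isLeast_card_gfaces_generate_of_comm`, stated for `G : Type`, whence `G : Type` in §2) are used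
BY NAME.  No definition, no `decide`, no certificate, no named fact, no `sorry`.  `Interfaces.lean` (C1), every E term, B01, `Transposition/*`,
`PortJoin/*`, `D2Bridge/*` untouched.
HONEST FRAMING: `HC_CM` is NOT proved, here or anywhere in the tree; nothing here is a period, a count of record or a headline.
T5: n/a-class (hypothesis binders: `|G| = 2ᵏ`, `k ≤ 3`, `c·c = 1`, `c ≠ 1`, `c` central — inhabited by `ℤ/2`; checker: self, 2026-08-25).
-/
import Summits.HodgeConjecture.CorCM.Census.IndexTwoCyclicTwoGroups
import Summits.HodgeConjecture.CorCM.Census.AbelianTwistDatum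
import HarnessLib

/-!
# The face census of every group of order `2`, `4` or `8`: `μ(G, c) = φ₂(G, c)`

A group of order `2ᵏ` with `k ≤ 3` EITHER has an element of order `2^{k−1}` — a cyclic subgroup of index two, settled by the capstone
`Census/IndexTwoCyclicTwoGroups.lean` (`k = 3`) or by the cyclic law (`k ≤ 2`) — OR has exponent `2` and is therefore abelian, settled by seat b09ʼs
abelian law `Census/AbelianTwistDatum.lean` (§1 `exists_index_two_or_forall_mul_self`).  Hence (§2)

* `isLeast_card_gfaces_generate_fibreTwo_of_forall_mul_self` — exponent two (elementary abelian), any order;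
* **`isLeast_card_gfaces_generate_fibreTwo_of_card_eq_eight`**, `…_of_card_eq_four`, `…_of_card_eq_two`, and the joint form
  **`isLeast_card_gfaces_generate_fibreTwo_of_card_two_pow_le_eight (hcard : |G| = 2ᵏ) (hk : k ≤ 3)`**: `μ(G, c) = φ₂(G, c)` for EVERY group of order
  `2`, `4`, `8` (`ℤ/2`, `ℤ/4`, `ℤ/2²`, `ℤ/8`, `ℤ/4 × ℤ/2`, `ℤ/2³`, `D₄`, `Q₈`) and EVERY central involution `c ≠ 1`.
Census dictionary: EVERY Galois CM field of degree `2`, `4` or `8` has exactly `φ₂(F)` generating faces (field level in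
`CorCM/FaceIndexTwoCyclicSmallDegrees.lean`); degree `16` is the first 2-power degree with open rows (`D₄ × ℤ/2`, `Q₈ × ℤ/2`, the Pauli group, …).

## References
* [Pohlmann1968] H. Pohlmann, Algebraic cycles on abelian varieties of complex multiplication type, Ann. of Math. 88 (1968), Thm 1.
-/

namespace Summit.HodgeConjecture.CorCM.Census.IndexTwoCyclic

open Finset
open Summit.HodgeConjecture.CorCM.Prior.AllgGroup.RfwfAllgGroup
open Summit.HodgeConjecture.CorCM.Census.BlockParity
open Summit.HodgeConjecture.CorCM.Census.Coinvariant

/-! ## §1 Small 2-groups: a cyclic subgroup of index two, or exponent two -/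

/-- If `ord x = 2ᵏ` with `k ≥ 1` then `ord (x²) = 2^{k−1}`. [folklore] -/
theorem orderOf_sq_of_orderOf_eq_two_pow {G : Type*} [Group G] {x : G} {k : ℕ} (hk : 1 ≤ k) (hx : orderOf x = 2 ^ k) :
    orderOf (x ^ 2) = 2 ^ (k - 1) := by
  obtain ⟨k', rfl⟩ : ∃ k', k = k' + 1 := ⟨k - 1, by omega⟩
  rw [orderOf_pow' x two_ne_zero, hx, Nat.add_sub_cancel, pow_succ, Nat.gcd_mul_left_left, Nat.mul_div_cancel _ two_pos]

/-- **A group of order `2ᵏ`, `1 ≤ k ≤ 3`, has an element generating a subgroup of index two, or has exponent two.** [folklore] -/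
theorem exists_index_two_or_forall_mul_self {G : Type*} [Group G] [Fintype G] {k : ℕ} (hcard : Fintype.card G = 2 ^ k) (hk1 : 1 ≤ k)
    (hk : k ≤ 3) : (∃ u : G, orderOf u = 2 ^ (k - 1) ∧ (Subgroup.zpowers u).index = 2) ∨ (∀ x : G, x * x = 1) := by
  by_cases h : ∃ u : G, orderOf u = 2 ^ (k - 1)
  · obtain ⟨u, hu⟩ := h
    refine Or.inl ⟨u, hu, ?_⟩
    have hci := (Subgroup.zpowers u).card_mul_index
    rw [Nat.card_zpowers, hu, Nat.card_eq_fintype_card, hcard] at hci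
    obtain ⟨k', rfl⟩ : ∃ k', k = k' + 1 := ⟨k - 1, by omega⟩
    rw [Nat.add_sub_cancel, pow_succ] at hci
    exact Nat.eq_of_mul_eq_mul_left (by positivity) hci
  · push Not at h
    right
    intro x
    have hdvd : orderOf x ∣ 2 ^ k := by rw [← hcard]; exact orderOf_dvd_card
    obtain ⟨i, hi, hix⟩ := (Nat.dvd_prime_pow Nat.prime_two).mp hdvd
    have hik : i ≠ k := by
      rintro rfl
      exact h (x ^ 2) (orderOf_sq_of_orderOf_eq_two_pow hk1 hix)
    have hik1 : i ≠ k - 1 := by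
      rintro rfl
      exact h x hix
    have hi1 : i ≤ 1 := by omega
    have h2 : orderOf x ∣ 2 := by
      rw [hix]
      exact Nat.pow_dvd_pow_iff_le_right'.mpr hi1 |>.trans (by norm_num)
    rw [← pow_two, ← orderOf_dvd_iff_pow_eq_one]
    exact h2

/-- **A group of order `4` that is not cyclic has exponent two.** [folklore] -/
theorem forall_mul_self_of_card_eq_four {G : Type*} [Group G] [Fintype G] (hcard : Fintype.card G = 4) (hcyc : ¬ IsCyclic G) (x : G) :
    x * x = 1 := by
  have hdvd : orderOf x ∣ 2 ^ 2 := by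
    rw [show (2 : ℕ) ^ 2 = 4 by norm_num, ← hcard]
    exact orderOf_dvd_card
  obtain ⟨i, hi, hix⟩ := (Nat.dvd_prime_pow Nat.prime_two).mp hdvd
  have hi2 : i ≠ 2 := by
    rintro rfl
    exact hcyc (isCyclic_of_orderOf_eq_card x (by rw [hix, Nat.card_eq_fintype_card, hcard]; norm_num))
  rw [← pow_two, ← orderOf_dvd_iff_pow_eq_one, hix]
  simpa using Nat.pow_dvd_pow 2 (show i ≤ 1 by omega)

/-! ## §2 The census -/

section Census

variable {G : Type} [Group G] [Fintype G] [DecidableEq G] {c : G} (hc2 : c * c = 1) (hc1 : c ≠ 1)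

include hc1 in
/-- **Exponent two: `μ(G, c) = φ₂(G, c)`** — an elementary abelian 2-group is abelian, seat b09ʼs abelian law (`Census/AbelianTwistDatum.lean`).
[folklore] -/
theorem isLeast_card_gfaces_generate_fibreTwo_of_forall_mul_self (hexp : ∀ x : G, x * x = 1) :
    IsLeast {m : ℕ | ∃ S : Finset (CMF G c →₀ ℤ), ↑S ⊆ gfaceSet G c hc2 ∧ S.card = m ∧
      hodgeSpan c hc2 ≤ Submodule.span ℤ (pairSet c) ⊔ Submodule.span ℤ (translates c S)} (fibreTwo c hc2) := by
  have hinv : ∀ x : G, x⁻¹ = x := fun x => inv_eq_of_mul_eq_one_right (hexp x)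
  letI : CommGroup G :=
    { ‹Group G› with
      mul_comm := fun a b => by rw [← hinv (a * b), mul_inv_rev, hinv, hinv] }
  exact TwistGeneration.isLeast_card_gfaces_generate_of_comm hc2 hc1

include hc1 in
/-- **ORDER `8`: `μ(G, c) = φ₂(G, c)`** for every group of order `8` (`ℤ/8`, `ℤ/4 × ℤ/2`, `ℤ/2³`, `D₄`, `Q₈`) and every central involution `c`.
[folklore] -/
theorem isLeast_card_gfaces_generate_fibreTwo_of_card_eq_eight (hcen : ∀ x : G, x * c = c * x) (hcard : Fintype.card G = 8) :
    IsLeast {m : ℕ | ∃ S : Finset (CMF G c →₀ ℤ), ↑S ⊆ gfaceSet G c hc2 ∧ S.card = m ∧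
      hodgeSpan c hc2 ≤ Submodule.span ℤ (pairSet c) ⊔ Submodule.span ℤ (translates c S)} (fibreTwo c hc2) := by
  rcases exists_index_two_or_forall_mul_self (k := 3) (by rw [hcard]; norm_num) (by norm_num) le_rfl with ⟨u, -, hu⟩ | hexp
  · exact isLeast_card_gfaces_generate_fibreTwo_of_two_group hc2 hc1 hcen u (k := 3) (by rw [hcard]; norm_num) le_rfl hu
  · exact isLeast_card_gfaces_generate_fibreTwo_of_forall_mul_self hc2 hc1 hexp

include hc1 in
/-- **ORDER `4`: `μ(G, c) = φ₂(G, c)`** (`ℤ/4`, `ℤ/2 × ℤ/2`, every involution `c`). [folklore] -/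
theorem isLeast_card_gfaces_generate_fibreTwo_of_card_eq_four (hcard : Fintype.card G = 4) :
    IsLeast {m : ℕ | ∃ S : Finset (CMF G c →₀ ℤ), ↑S ⊆ gfaceSet G c hc2 ∧ S.card = m ∧
      hodgeSpan c hc2 ≤ Submodule.span ℤ (pairSet c) ⊔ Submodule.span ℤ (translates c S)} (fibreTwo c hc2) := by
  by_cases hcyc : IsCyclic G
  · exact isLeast_card_gfaces_generate_fibreTwo_of_isCyclic hc2 hc1
  · exact isLeast_card_gfaces_generate_fibreTwo_of_forall_mul_self hc2 hc1 (forall_mul_self_of_card_eq_four hcard hcyc)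

include hc1 in
/-- **ORDER `2`: `μ(G, c) = φ₂(G, c)`** (`G = {1, c}`, the imaginary quadratic case; both sides vanish). [folklore] -/
theorem isLeast_card_gfaces_generate_fibreTwo_of_card_eq_two (hcard : Fintype.card G = 2) :
    IsLeast {m : ℕ | ∃ S : Finset (CMF G c →₀ ℤ), ↑S ⊆ gfaceSet G c hc2 ∧ S.card = m ∧
      hodgeSpan c hc2 ≤ Submodule.span ℤ (pairSet c) ⊔ Submodule.span ℤ (translates c S)} (fibreTwo c hc2) := by
  haveI : Fact (Nat.Prime 2) := ⟨Nat.prime_two⟩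
  haveI : IsCyclic G := isCyclic_of_prime_card (p := 2) (by rw [Nat.card_eq_fintype_card, hcard])
  exact isLeast_card_gfaces_generate_fibreTwo_of_isCyclic hc2 hc1

include hc1 in
/-- **`μ(G, c) = φ₂(G, c)` FOR EVERY GROUP OF ORDER `2ᵏ ≤ 8` AND EVERY CENTRAL INVOLUTION.** [folklore] -/
theorem isLeast_card_gfaces_generate_fibreTwo_of_card_two_pow_le_eight (hcen : ∀ x : G, x * c = c * x) {k : ℕ}
    (hcard : Fintype.card G = 2 ^ k) (hk : k ≤ 3) :
    IsLeast {m : ℕ | ∃ S : Finset (CMF G c →₀ ℤ), ↑S ⊆ gfaceSet G c hc2 ∧ S.card = m ∧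
      hodgeSpan c hc2 ≤ Submodule.span ℤ (pairSet c) ⊔ Submodule.span ℤ (translates c S)} (fibreTwo c hc2) := by
  have hk0 : k ≠ 0 := by
    rintro rfl
    rw [pow_zero] at hcard
    exact hc1 (Fintype.card_le_one_iff.mp hcard.le c 1)
  interval_cases k
  · exact absurd rfl hk0
  · exact isLeast_card_gfaces_generate_fibreTwo_of_card_eq_two hc2 hc1 hcard
  · exact isLeast_card_gfaces_generate_fibreTwo_of_card_eq_four hc2 hc1 hcard
  · exact isLeast_card_gfaces_generate_fibreTwo_of_card_eq_eight hc2 hc1 hcen hcard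

end Census

end Summit.HodgeConjecture.CorCM.Census.IndexTwoCyclic
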